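import Summits.BirchSwinnertonDyer.Rank1Residual.Additive.TameBranchLambdaParityRankOne
import Summits.BirchSwinnertonDyer.Rank1Residual.Additive.TameBranchExtraZerosCertificate
import HarnessLib

/-!
# THE PARITY OF `λ` ON THE TAME BRANCH at rank one — every defect from the typed Kato half, and
# defect 3, 4, 6 from PRINT + two values + ONE Riemann sum: `λ(X)` odd, the two-sided sandwich, the
# dichotomy at `λ_an = 3`, and the squeeze ⟹ the RATIONAL main conjecture at the pair for THE tame branch
# (cell `b2b-bsdres`, sub-cell additive-p2 = X3♯(G-ord)/X4♯(G-ord), gen 30; part 4)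

HONEST FRAMING (cell `b2b-bsdres`, run/shared/lean/b2b/bsd-rank1-residual/, verbatim in every
file): the goal of the cell is to DELETE the COMBINATION-SHAPED residual classes of the
Birch–Swinnerton-Dyer formula for ALL analytic-rank `≤ 1` elliptic curves over `ℚ` — "full BSD
formula for every rank `≤ 1` curve in class `C`" assembled STRICTLY from published theorems — so
that the rank-`≤ 1` remainder becomes exactly the CONSTRUCTION-SHAPED classes, which are TYPED
(missing-input `Prop`s), NOT attempted. This is not "finishing BSD". Sub-cell additive-p2: the
classes X3♯(G-ord) / X4♯(G-ord) are CONSTRUCTION-SHAPED and stay so; labels / RESIDUAL-MAP marks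
UNCHANGED; nothing is booked. Theorems only; published inputs are hypothesis binders (A282 = Delbourgo
1998 Thm 1, A175/A227 = Delbourgo 2002 (A)(B)/(C), GZK, Greenberg 1999 Prop. 3.10
`prop310_selmerCorank_mod_two_eq_lambdaInvariant`). No definition, no named fact, no `sorry`.

## What and why

* §8 every defect ((M) included): `TameBranchRatDvdAt W p` + ANY tuple `(f, ε, α, B)` of the package with
  a FIRST TOP at `n` and `[T¹]B ≠ 0` ⟹ part 2's sandwich / parity / dichotomy / squeeze per datum, and
  the squeeze ⟹ `char_Λ X = (G)`, `ι G = p^{μ(fE)+c}·B` (`TameBranchRatCharEqAt`'s conclusion for the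
  tuple, exponent identified).
* §9 defect 3, 4, 6 from PRINT (gen 29's join + Prop. 3.10): `p ≥ 5`, ADDITIVE, (G)-ordinary, non-CM,
  `e ∈ {3,4,6}`, `ord_{s=1} L(E,s) = 1`; a (G)-field and THE unit root `ã`, `χ = ω^u`, tower bound `p^c`,
  TWO values on one line `t ∈ {1, e−1}` with common `k` (`e·k < 2φₙ`), ONE Riemann sum of the forced
  partner with `p^c·p^{−n₁} < ‖RS 1 n₁‖` ⟹ for every (B)-datum and every cyclotomic dual datum with
  generator `fE`: **`λ(fE)` ODD, `1 ≤ λ(fE) ≤ k`, `μ(fE) + 1 + 2t ≤ LHS ≤ μ(fE) + ord_p RS(1,n₁) + c + 1 +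
  2t`** (left `=` iff `λ(fE) = 1`, right `=` iff `λ(fE) = k`), at `k = 3` the DICHOTOMY `λ(fE) ∈ {1,3}`,
  and the SQUEEZE `μ(fE) + 1 + 2t < LHS ⟹ 3 ≤ λ(fE)` (`= 3`, upper equality, when `k = 3`);
* §9 (`k = 3`): **THE E-normalised tame branch `B` of the forced partner EXISTS (first top at `3`,
  `‖[T¹]B‖ = ‖RS 1 n₁‖`) and, for every datum whose generator satisfies `μ(fE) ≤ m` with
  `m + 1 + 2t < v + ord_p ∏c` for a certified `v ≤ ord_p Reg_p`: `λ(fE) = 3` and `char_Λ X(E/ℚ_∞) = (G)`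
  with `ι G = p^{μ(fE)+c}·B`** — Delbourgo's main conjecture (G) at the pair, rationally, with exponent
  `μ(X) + c`; under `μ(X) = 0` on X4 (`c = 0`): `char_Λ X = (ι⁻¹ B_E)` INTEGRALLY.

Class forms (X4♯(G-ord): `c = 0`; X3♯(G-ord)) are part 5. Window reading (EVIDENCE; nothing booked): the
three `λ_an = 3` rank-1 rows 175a1@5, 10878bk1@7, 11760bb1@7 meet the squeeze inequality with `m = 0`.

References: [Delbourgo1998] Thm. 1; [Delbourgo2002] Thm. (A)(B)(C); [GreenbergLNM1716] Prop. 3.10, §5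
p. 183; [GreenbergVatsal2000] p. 4; [SteinWuthrich2013] §3; [MazurTateTeitelbaum1986Invent] §I.10–I.14;
[Washington1997] §7.1; `TameBranchExtraZerosCertificate.lean` (gen 29). -/

set_option autoImplicit false

noncomputable section

open scoped Classical MatrixGroups ModularForm NumberField

open CongruenceSubgroup IsDedekindDomain WeierstrassCurve NumberField
  Literature.NumberTheory.EllipticCurves
  Literature.NumberTheory.EllipticCurves.ModularForms
  Literature.NumberTheory.EllipticCurves.Rank1Residual
  Literature.NumberTheory.EllipticCurves.Rank1Residual.Typed
  Literature.NumberTheory.EllipticCurves.Delbourgo2002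
  Literature.NumberTheory.EllipticCurves.Greenberg1999
  Summit.BirchSwinnertonDyer.Rank1Residual.X1.MuLambda
  Summit.BirchSwinnertonDyer.Rank1Residual.X1.ParitySqueeze
  Summit.BirchSwinnertonDyer.Rank1Residual.X1.RankOneParitySqueeze
  Summit.BirchSwinnertonDyer.Rank1Residual.X11a.LambdaNorm

namespace Summit.BirchSwinnertonDyer.Rank1Residual.Additive

/-! ### §8 Rank one, every defect ((M) included): the typed Kato half + ANY tuple with a first top -/

section EveryDefectOne

open TameBranchExtraZeros TameBranchLambdaParity

variable {W : WeierstrassCurve ℚ} [W.IsElliptic] [W.IsGloballyMinimal] {p : ℕ} [hp : Fact p.Prime]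
  {N : ℕ} [NeZero N] {f : CuspForm (Gamma0 N) 2}

/-- **RANK ONE, every defect ((M) included): sandwich, parity, dichotomy, squeeze.** `p ≠ 2` additive of
type (M) or (G-ord), `TameBranchRatDvdAt W p` (Delbourgo 2002 (C)), ANY tuple `(f, ε, α, B)` of the
package with bound `p^c`, FIRST TOP at `n` (`= λ_an`) and `[T¹]B ≠ 0`, `rank_ℤ E(ℚ) = 1`, a (B)-datum
and Greenberg's Prop. 3.10. Then for every cyclotomic dual datum with generator `fE`: Schneider,
`#Ш[p^∞] < ∞`, **`λ(fE)` ODD, `1 ≤ λ(fE) ≤ n`**, **`μ(fE) + 1 + 2t ≤ LHS ≤ μ(fE) + ord_p[T¹]B + c + 1 + 2t`**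
(left `=` iff `λ(fE) = 1`, right `=` iff `λ(fE) = n`), at `n = 3` the dichotomy `λ(fE) ∈ {1,3}`, and the
squeeze `μ(fE) + 1 + 2t < LHS ⟹ 3 ≤ λ(fE)` (`= 3` with the upper equality when `n = 3`).
[cite: Delbourgo2002, Theorem (A), (B), (C) (p. 40)] [cite: GreenbergLNM1716, Prop. 3.10]
[cite: Washington1997, §7.1] -/
theorem sandwich_rankOne_of_tameBranchRatDvdAt_of_firstTop
    (h310 : prop310_selmerCorank_mod_two_eq_lambdaInvariant) (hT : TameBranchRatDvdAt W p)
    {ε : DirichletCharacter ℂ_[p] p} {α : ℚ_[p]} {B : PowerSeries ℚ_[p]}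
    (hp2 : p ≠ 2) (hadd : Addv W p) (hloc : PotMult W p ∨ TypeGOrd W p)
    (hf : IsNewformOf W f) (hε : orderOf ε = tameDefect W p) (hα : ‖α‖ = 1)
    (hB : IsTameBranchOf f p ε α B) {c : ℕ} (hbd : ∀ j : ℕ, ‖PowerSeries.coeff j B‖ ≤ (p : ℝ) ^ c)
    {n : ℕ} (hn : ‖PowerSeries.coeff n B‖ = (p : ℝ) ^ c)
    (hlt : ∀ i < n, ‖PowerSeries.coeff i B‖ < (p : ℝ) ^ c) (hB1 : PowerSeries.coeff 1 B ≠ 0)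
    (hr1 : W.mordellWeilRank = 1) {Dh : PAdicHeightData W p} (hBcl : LeadingTermClauses W p Dh)
    {κ : ZpExtension ℚ p} {γ : Field.absoluteGaloisGroup ℚ}
    (hκ : κ.IsCyclotomic) (hγ : κ.IsTopGenerator γ) (hγ' : IsCyclotomicVariable p γ)
    (D : W.SelmerDualData κ γ) [Module.Finite (IwasawaAlgebra p) D.X]
    {fE : IwasawaAlgebra p} (hchar : D.charIdeal = Ideal.span {fE}) :
    SchneiderConjecture Dh ∧ Finite (AddCommGroup.primaryComponent W.sha p) ∧
      Odd (lam fE) ∧ 1 ≤ lam fE ∧ lam fE ≤ n ∧ (lam fE = 1 ∨ 3 ≤ lam fE) ∧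
      ∃ ℓ : ℕ, ℓ ∣ p ^ 2 ∧ (ReductionNonAnomalous W p → ℓ = 1) ∧
        (X1.MuLambda.mu fE : ℤ) + 1 + 2 * padicValNat p W.torsionOrder ≤
          (padicValNat p (Nat.card (AddCommGroup.primaryComponent W.sha p)) : ℤ) +
            (padicRegulator Dh).valuation + padicValNat p W.tamagawaProduct + padicValNat p ℓ ∧
        ((X1.MuLambda.mu fE : ℤ) + 1 + 2 * padicValNat p W.torsionOrder =
          (padicValNat p (Nat.card (AddCommGroup.primaryComponent W.sha p)) : ℤ) +
            (padicRegulator Dh).valuation + padicValNat p W.tamagawaProduct + padicValNat p ℓ ↔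
          lam fE = 1) ∧
        (padicValNat p (Nat.card (AddCommGroup.primaryComponent W.sha p)) : ℤ) +
            (padicRegulator Dh).valuation + padicValNat p W.tamagawaProduct + padicValNat p ℓ ≤
          X1.MuLambda.mu fE + (PowerSeries.coeff 1 B).valuation + c + 1 +
            2 * padicValNat p W.torsionOrder ∧
        ((padicValNat p (Nat.card (AddCommGroup.primaryComponent W.sha p)) : ℤ) +
            (padicRegulator Dh).valuation + padicValNat p W.tamagawaProduct + padicValNat p ℓ =
          X1.MuLambda.mu fE + (PowerSeries.coeff 1 B).valuation + c + 1 +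
            2 * padicValNat p W.torsionOrder ↔ lam fE = n) ∧
        (n = 3 → lam fE = 1 ∨ lam fE = 3) ∧
        ((X1.MuLambda.mu fE : ℤ) + 1 + 2 * padicValNat p W.torsionOrder <
          (padicValNat p (Nat.card (AddCommGroup.primaryComponent W.sha p)) : ℤ) +
            (padicRegulator Dh).valuation + padicValNat p W.tamagawaProduct + padicValNat p ℓ →
          3 ≤ lam fE) ∧
        (n = 3 → (X1.MuLambda.mu fE : ℤ) + 1 + 2 * padicValNat p W.torsionOrder <
          (padicValNat p (Nat.card (AddCommGroup.primaryComponent W.sha p)) : ℤ) +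
            (padicRegulator Dh).valuation + padicValNat p W.tamagawaProduct + padicValNat p ℓ →
          lam fE = 3 ∧
          (padicValNat p (Nat.card (AddCommGroup.primaryComponent W.sha p)) : ℤ) +
            (padicRegulator Dh).valuation + padicValNat p W.tamagawaProduct + padicValNat p ℓ =
          X1.MuLambda.mu fE + (PowerSeries.coeff 1 B).valuation + c + 1 +
            2 * padicValNat p W.torsionOrder) := by
  obtain ⟨hX, g, hg, k, hι⟩ := hT ε α B hp2 hadd hloc hκ hγ hγ' hf hε hα hB D
  exact sandwich_rankOne_of_iota_eq_of_firstTop h310 hp2 hr1 hBcl hκ hγ hγ' D hX hchar hg hι hbd hn hlt hB1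

/-- **RANK ONE, every defect: the squeeze ⟹ the RATIONAL MAIN CONJECTURE AT THE PAIR.** In the setting of
`sandwich_rankOne_of_tameBranchRatDvdAt_of_firstTop` with `n = 3`, `μ(fE) ≤ m` and
`m + 1 + 2·ord_p #tors < v + ord_p ∏c` with `v ≤ ord_p Reg_p(E,Dh)`: **`X` is torsion, `λ(fE) = 3`, and
`char_Λ X(E/ℚ_∞) = (G)` with `ι G = p^{μ(fE)+c}·B`** — the conclusion of `TameBranchRatCharEqAt` for this
tuple and datum, exponent `μ + c`. [cite: Delbourgo2002, Theorem (A), (B), (C) (p. 40)]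
[cite: GreenbergLNM1716, Prop. 3.10 and §5 p. 183] [cite: GreenbergVatsal2000, p. 4] -/
theorem charIdeal_eq_span_and_iota_eq_of_tameBranchRatDvdAt_of_squeeze_rankOne
    (h310 : prop310_selmerCorank_mod_two_eq_lambdaInvariant) (hT : TameBranchRatDvdAt W p)
    {ε : DirichletCharacter ℂ_[p] p} {α : ℚ_[p]} {B : PowerSeries ℚ_[p]}
    (hp2 : p ≠ 2) (hadd : Addv W p) (hloc : PotMult W p ∨ TypeGOrd W p)
    (hf : IsNewformOf W f) (hε : orderOf ε = tameDefect W p) (hα : ‖α‖ = 1)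
    (hB : IsTameBranchOf f p ε α B) {c : ℕ} (hbd : ∀ j : ℕ, ‖PowerSeries.coeff j B‖ ≤ (p : ℝ) ^ c)
    (hn : ‖PowerSeries.coeff 3 B‖ = (p : ℝ) ^ c)
    (hlt : ∀ i < 3, ‖PowerSeries.coeff i B‖ < (p : ℝ) ^ c) (hB1 : PowerSeries.coeff 1 B ≠ 0)
    (hr1 : W.mordellWeilRank = 1) {Dh : PAdicHeightData W p} (hBcl : LeadingTermClauses W p Dh)
    {κ : ZpExtension ℚ p} {γ : Field.absoluteGaloisGroup ℚ}
    (hκ : κ.IsCyclotomic) (hγ : κ.IsTopGenerator γ) (hγ' : IsCyclotomicVariable p γ)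
    (D : W.SelmerDualData κ γ) [Module.Finite (IwasawaAlgebra p) D.X]
    {fE : IwasawaAlgebra p} (hchar : D.charIdeal = Ideal.span {fE})
    {m : ℕ} (hμ : X1.MuLambda.mu fE ≤ m) {v : ℤ} (hv : v ≤ (padicRegulator Dh).valuation)
    (hb : (m : ℤ) + 1 + 2 * padicValNat p W.torsionOrder < v + padicValNat p W.tamagawaProduct) :
    D.IsTorsion ∧ lam fE = 3 ∧
      ∃ G : IwasawaAlgebra p, D.charIdeal = Ideal.span {G} ∧
        X1.MuLambda.mu G = X1.MuLambda.mu fE ∧ lam G = 3 ∧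
        iwasawaToPowerSeries p G = PowerSeries.C ((p : ℚ_[p]) ^ (X1.MuLambda.mu fE + c)) * B := by
  obtain ⟨hX, g, hg, k, hι⟩ := hT ε α B hp2 hadd hloc hκ hγ hγ' hf hε hα hB D
  exact ⟨hX, charIdeal_eq_span_and_iota_eq_of_squeeze_rankOne h310 hp2 hr1 hBcl hκ hγ hγ' D hX hchar hg
    hι hbd hn hlt hB1 hμ hv hb⟩

end EveryDefectOne

/-! ### §9 Defect 3, 4, 6 at rank one from PRINT + two values + ONE Riemann sum + Prop. 3.10 -/

namespace TwistPartner

open TameBranchOneValue TameBranchTwoValue TameBranchExtraZeros TameBranchLambdaParity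

section Join

variable {W : WeierstrassCurve ℚ} [W.IsElliptic] [W.IsGloballyMinimal] {p : ℕ} [hp : Fact p.Prime]
  {N : ℕ} [NeZero N] {f : CuspForm (Gamma0 N) 2} {χ : MulChar (ZMod p) ℚ_[p]} {ã : ℚ_[p]} {t : ℕ}
  {RS : ℕ → ℕ → ℚ_[p]}
  (hRS : ∀ k n : ℕ, RS k n =
      ∑ᶠ ξ : rootsOfUnity (Literature.NumberTheory.EllipticCurves.torsionOrder p) ℤ_[p],
        ∑ s : ZMod (p ^ n),
        twistPartnerMeasure (χ ^ t)
            (TwistPartner.forced (χ ^ t) (fun r ↦ ((ratPlusSymbol f r : ℚ) : ℚ_[p])) ã) ã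
            ((ratPlusSymbol f 0 : ℚ) : ℚ_[p]) (n + cyclotomicExponent p)
            (PadicInt.toZModPow (n + cyclotomicExponent p) ((ξ : ℤ_[p]ˣ) : ℤ_[p]) *
              (cyclotomicGenerator p : ZMod (p ^ (n + cyclotomicExponent p))) ^ s.val) *
          ((s.val.choose k : ℕ) : ℚ_[p]))

include hRS

/-- **THE TAME BRANCH OF THE FORCED PARTNER WITH FIRST TOP `k` AND EXACT LINEAR COEFFICIENT (from PRINT,
two values, one Riemann sum).** `p ≥ 5`, ADDITIVE, (G)-ordinary, `e ∈ {3,4,6}`; Delbourgo 1998 Thm 1; a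
(G)-field `F`, `w ∣ p`, THE unit root `ã`; `χ = ω^u` of order `e`; tower bound `p^c`; TWO even primitive
`p`-power-order characters at consecutive conductors with values on ONE line `t ∈ {1, e−1}`, common `k`,
`e·k < 2φₙ`; ONE Riemann sum with `p^c·p^{−n₁} < ‖RS 1 n₁‖`. Then a `B` with
`IsTameBranchOf f p (ι∘χ^t) ã B` EXISTS, bounded by `p^c`, with FIRST TOP at `k`, `[T¹]B ≠ 0` and
`v_p([T¹]B) = v_p(RS(1,n₁))`. (Gen 29's join, exposed as a witness.) [cite: Delbourgo1998, Theorem 1 (p. 131)]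
[cite: SteinWuthrich2013, §3] [cite: MazurTateTeitelbaum1986Invent, §I.10–I.14] -/
theorem exists_isTameBranchOf_firstTop_coeff_one_of_thm1_of_two_norm_ratTwistedSymbolSum_of_riemannSum
    (hD : Delbourgo1998.thm1_exists_bounded_evenMeasure) (h5 : 5 ≤ p) (hadd : Addv W p)
    (hGord : TypeGOrd W p) (he : semistabilityIndex W p ∈ ({3, 4, 6} : Finset ℕ)) (hf : IsNewformOf W f)
    {L : Type} [Field L] [NumberField L] [IsCyclotomicExtension {p} ℚ L] (F : IntermediateField ℚ L)
    (hF : ∀ w : HeightOneSpectrum (𝓞 F), (p : 𝓞 F) ∈ w.asIdeal →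
      (W.baseChange F).HasGoodReductionAt w ∧ (W.baseChange F).HasUnitRootAt w)
    (w : HeightOneSpectrum (𝓞 F)) (hw : (p : 𝓞 F) ∈ w.asIdeal)
    (hã : ‖ã‖ = 1) (hroot : ã ^ 2 - (((W.baseChange F).frobeniusTraceAt w : ℤ) : ℚ_[p]) * ã + p = 0)
    (hχe : orderOf χ = semistabilityIndex W p) {u : ℕ} (hu : semistabilityIndex W p * u = p - 1)
    (hteich : ∀ a : ZMod p, a ≠ 0 → ‖χ a - ((a.val : ℕ) : ℚ_[p]) ^ u‖ < 1) {c : ℕ}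
    (hc : ∀ (m : ℕ) (a : ℤ), ‖((ratPlusSymbol f ((a : ℚ) / (p : ℚ) ^ m) : ℚ) : ℚ_[p])‖ ≤ (p : ℝ) ^ c)
    {n : ℕ} {κ : DirichletCharacter ℂ_[p] (p ^ (n + 1 + cyclotomicExponent p))} (hκ : κ.IsPrimitive)
    (heven : κ.Even) (hord : ∃ j : ℕ, orderOf κ = p ^ j)
    {κ' : DirichletCharacter ℂ_[p] (p ^ (n + 1 + 1 + cyclotomicExponent p))} (hκ' : κ'.IsPrimitive)
    (heven' : κ'.Even) (hord' : ∃ j : ℕ, orderOf κ' = p ^ j) {k : ℕ}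
    (ht : t = 1 ∨ t = semistabilityIndex W p - 1)
    (hk2 : semistabilityIndex W p * k < 2 * Nat.totient (p ^ (n + 1)))
    (hval : ‖ratTwistedSymbolSum f κ‖ ^ (semistabilityIndex W p * Nat.totient (p ^ (n + 1))) =
      ((p : ℝ) ^ c) ^ (semistabilityIndex W p * Nat.totient (p ^ (n + 1))) *
        ((p : ℝ)⁻¹) ^ (semistabilityIndex W p * k + t * Nat.totient (p ^ (n + 1))))
    (hval' : ‖ratTwistedSymbolSum f κ'‖ ^ (semistabilityIndex W p * Nat.totient (p ^ (n + 1 + 1))) =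
      ((p : ℝ) ^ c) ^ (semistabilityIndex W p * Nat.totient (p ^ (n + 1 + 1))) *
        ((p : ℝ)⁻¹) ^ (semistabilityIndex W p * k + t * Nat.totient (p ^ (n + 1 + 1))))
    {n₁ : ℕ} (hlt : (p : ℝ) ^ c * (p : ℝ) ^ (-(n₁ : ℤ)) < ‖RS 1 n₁‖) :
    ∃ B : PowerSeries ℚ_[p],
      IsTameBranchOf f p ((χ ^ t).ringHomComp (algebraMap ℚ_[p] ℂ_[p])) ã B ∧
      orderOf ((χ ^ t).ringHomComp (algebraMap ℚ_[p] ℂ_[p])) = tameDefect W p ∧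
      (∀ j : ℕ, ‖PowerSeries.coeff j B‖ ≤ (p : ℝ) ^ c) ∧
      ‖PowerSeries.coeff k B‖ = (p : ℝ) ^ c ∧ (∀ i < k, ‖PowerSeries.coeff i B‖ < (p : ℝ) ^ c) ∧
      PowerSeries.coeff 1 B ≠ 0 ∧ (PowerSeries.coeff 1 B).valuation = (RS 1 n₁).valuation := by
  have hp2 : p ≠ 2 := by omega
  have h3 : 3 ≤ semistabilityIndex W p := three_le_of_mem he
  have h2 : 2 ≤ semistabilityIndex W p := by omega
  have hG : SubGord W p := (subGord_iff_typeG_of_addv W p hp2 hadd).mpr hGord.typeG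
  obtain ⟨C₀, hC₀⟩ := towerBounded_forced_pow_of_thm1_of_two_norm_ratTwistedSymbolSum hD h5 hadd he hf F
    hF w hw hã hroot hχe hu hteich hc hκ heven hord hκ' heven' hord' ht hk2 hval hval'
  have hordt : orderOf (χ ^ t) = semistabilityIndex W p := orderOf_pow_eq_of_mem hχe (by omega) ht
  have hne1 : χ ^ t ≠ 1 := by
    intro h
    rw [h, orderOf_one] at hordt
    omega
  have hU0 := sum_ratPlusSymbol_add_div_eq_zero_of_addv W hf hadd
  obtain ⟨B, hB, hint, hRSle⟩ :=
    exists_isTameBranchOf_riemannSum_of_towerBounded_forced hRS hne1 hã hU0 hC₀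
  have hbdB : ∀ j : ℕ, ‖PowerSeries.coeff j B‖ ≤ (p : ℝ) ^ c := hint _ hc
  have herr : ‖PowerSeries.coeff 1 B - RS 1 n₁‖ < ‖RS 1 n₁‖ := by
    have hle := hRSle _ hc 1 n₁
    rw [Nat.factorial_one, Nat.cast_one, norm_one, div_one] at hle
    exact hle.trans_lt hlt
  obtain ⟨hne, -, hvaleq⟩ := valuation_eq_of_norm_sub_lt herr
  have hkφ : k < Nat.totient (p ^ (n + 1)) := lt_of_mul_lt_two_mul h2 hk2
  have hfirst : ‖PowerSeries.coeff k B‖ = (p : ℝ) ^ c ∧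
      ∀ i < k, ‖PowerSeries.coeff i B‖ < (p : ℝ) ^ c := by
    rcases ht with rfl | rfl
    · rw [one_mul] at hval
      have hB' : IsTameBranchOf f p (χ.ringHomComp (algebraMap ℚ_[p] ℂ_[p])) ã B := by
        rw [pow_one] at hB; exact hB
      exact hB'.firstTop_of_norm_ratTwistedSymbolSum_pow_eq hã hbdB hteich hχe h2 hu hκ heven hord hkφ hval
    · have hB' : IsTameBranchOf f p (χ⁻¹.ringHomComp (algebraMap ℚ_[p] ℂ_[p])) ã B := by
        rw [pow_sub_one_eq_inv_of_orderOf hχe (by omega)] at hB; exact hB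
      exact hB'.firstTop_of_norm_ratTwistedSymbolSum_pow_eq_inv hã hbdB hteich hχe h2 hu hκ heven hord
        hkφ hval
  have hordε : orderOf ((χ ^ t).ringHomComp (algebraMap ℚ_[p] ℂ_[p])) = tameDefect W p := by
    rw [orderOf_ringHomComp_padicComplex, hordt, tameDefect_of_not_potMult W p hG.1]
  exact ⟨B, hB, hordε, hbdB, hfirst.1, hfirst.2, hne, hvaleq⟩

/-- **`ord_{s=1}L(E,s) = 1`, ANY `λ_an = k`, defect 3, 4, 6 — PARITY, SANDWICH, DICHOTOMY, SQUEEZE AND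
THE MAIN CONJECTURE AT THE PAIR, FROM PRINT + TWO VALUES + ONE RIEMANN SUM.** `p ≥ 5`, ADDITIVE,
(G)-ordinary, non-CM, `e ∈ {3,4,6}`; Delbourgo 1998 Thm 1, 2002 (A)(B)(C), GZK, Greenberg Prop. 3.10; a
(G)-field with THE unit root `ã`; `χ = ω^u`; tower bound `p^c`; TWO values on one line `t` with common
`k`; ONE Riemann sum with `p^c·p^{−n₁} < ‖RS 1 n₁‖`. Then THE branch `B` of the forced partner exists
(first top `k`), a (B)-datum exists, and for EVERY (B)-datum `Dh` and every cyclotomic dual datum `D`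
with generator `fE`: `X` torsion, Schneider, `#Ш[p^∞] < ∞`, **`λ(fE)` ODD, `1 ≤ λ(fE) ≤ k`**,
**`μ(fE) + 1 + 2t ≤ LHS ≤ μ(fE) + ord_p RS(1,n₁) + c + 1 + 2t`** (left `=` iff `λ(fE) = 1`, right `=` iff
`λ(fE) = k`), at `k = 3` the dichotomy `λ(fE) ∈ {1,3}`; and **the SQUEEZE: if `μ(fE) ≤ m` and
`m + 1 + 2t < v + ord_p ∏c` for some `v ≤ ord_p Reg_p(E,Dh)`, then `3 ≤ λ(fE)`, and at `k = 3`: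
`λ(fE) = 3`, `LHS = μ(fE) + ord_p RS(1,n₁) + c + 1 + 2t`, and `char_Λ X = (G)` with `ι G = p^{μ(fE)+c}·B`**
— Delbourgo's main conjecture (G) at the pair, rationally, exponent `μ(X) + c`. Nothing booked.
[cite: Delbourgo1998, Theorem 1 (p. 131)] [cite: Delbourgo2002, Theorem (A), (B), (C) (p. 40)]
[cite: GreenbergLNM1716, Prop. 3.10 and §5 p. 183] [cite: GreenbergVatsal2000, p. 4]
[cite: SteinWuthrich2013, §3] [cite: Washington1997, §7.1] -/
theorem exists_sandwich_rankOne_of_thm1_of_two_norm_ratTwistedSymbolSum_of_riemannSum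
    (h310 : prop310_selmerCorank_mod_two_eq_lambdaInvariant)
    (hD : Delbourgo1998.thm1_exists_bounded_evenMeasure)
    (hC : Delbourgo2002.thmC_charIdeal_dvd_tameBranch) (hDel : Delbourgo2002.mainTheorem)
    (hDelM : Delbourgo2002.mainTheorem_potMult) (hGZK : rank_eq_analyticRank_of_analyticRank_le_one)
    (h5 : 5 ≤ p) (hcm : ¬ W.HasCM) (hadd : Addv W p) (hGord : TypeGOrd W p)
    (he : semistabilityIndex W p ∈ ({3, 4, 6} : Finset ℕ)) (hr : W.analyticRank = 1)
    (hf : IsNewformOf W f)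
    {L : Type} [Field L] [NumberField L] [IsCyclotomicExtension {p} ℚ L] (F : IntermediateField ℚ L)
    (hF : ∀ w : HeightOneSpectrum (𝓞 F), (p : 𝓞 F) ∈ w.asIdeal →
      (W.baseChange F).HasGoodReductionAt w ∧ (W.baseChange F).HasUnitRootAt w)
    (w : HeightOneSpectrum (𝓞 F)) (hw : (p : 𝓞 F) ∈ w.asIdeal)
    (hã : ‖ã‖ = 1) (hroot : ã ^ 2 - (((W.baseChange F).frobeniusTraceAt w : ℤ) : ℚ_[p]) * ã + p = 0)
    (hχe : orderOf χ = semistabilityIndex W p) {u : ℕ} (hu : semistabilityIndex W p * u = p - 1)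
    (hteich : ∀ a : ZMod p, a ≠ 0 → ‖χ a - ((a.val : ℕ) : ℚ_[p]) ^ u‖ < 1) {c : ℕ}
    (hc : ∀ (m : ℕ) (a : ℤ), ‖((ratPlusSymbol f ((a : ℚ) / (p : ℚ) ^ m) : ℚ) : ℚ_[p])‖ ≤ (p : ℝ) ^ c)
    {n : ℕ} {κ : DirichletCharacter ℂ_[p] (p ^ (n + 1 + cyclotomicExponent p))} (hκ : κ.IsPrimitive)
    (heven : κ.Even) (hord : ∃ j : ℕ, orderOf κ = p ^ j)
    {κ' : DirichletCharacter ℂ_[p] (p ^ (n + 1 + 1 + cyclotomicExponent p))} (hκ' : κ'.IsPrimitive)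
    (heven' : κ'.Even) (hord' : ∃ j : ℕ, orderOf κ' = p ^ j) {k : ℕ}
    (ht : t = 1 ∨ t = semistabilityIndex W p - 1)
    (hk2 : semistabilityIndex W p * k < 2 * Nat.totient (p ^ (n + 1)))
    (hval : ‖ratTwistedSymbolSum f κ‖ ^ (semistabilityIndex W p * Nat.totient (p ^ (n + 1))) =
      ((p : ℝ) ^ c) ^ (semistabilityIndex W p * Nat.totient (p ^ (n + 1))) *
        ((p : ℝ)⁻¹) ^ (semistabilityIndex W p * k + t * Nat.totient (p ^ (n + 1))))
    (hval' : ‖ratTwistedSymbolSum f κ'‖ ^ (semistabilityIndex W p * Nat.totient (p ^ (n + 1 + 1))) =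
      ((p : ℝ) ^ c) ^ (semistabilityIndex W p * Nat.totient (p ^ (n + 1 + 1))) *
        ((p : ℝ)⁻¹) ^ (semistabilityIndex W p * k + t * Nat.totient (p ^ (n + 1 + 1))))
    {n₁ : ℕ} (hlt : (p : ℝ) ^ c * (p : ℝ) ^ (-(n₁ : ℤ)) < ‖RS 1 n₁‖) :
    ∃ B : PowerSeries ℚ_[p],
      IsTameBranchOf f p ((χ ^ t).ringHomComp (algebraMap ℚ_[p] ℂ_[p])) ã B ∧
      ‖PowerSeries.coeff k B‖ = (p : ℝ) ^ c ∧ (∀ i < k, ‖PowerSeries.coeff i B‖ < (p : ℝ) ^ c) ∧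
      (PowerSeries.coeff 1 B).valuation = (RS 1 n₁).valuation ∧
    (∃ Dh : PAdicHeightData W p, LeadingTermClauses W p Dh) ∧
    ∀ Dh : PAdicHeightData W p, LeadingTermClauses W p Dh →
      ∀ (K : ZpExtension ℚ p) (γ : Field.absoluteGaloisGroup ℚ),
        K.IsCyclotomic → K.IsTopGenerator γ → IsCyclotomicVariable p γ →
        ∀ (D : W.SelmerDualData K γ) (fE : IwasawaAlgebra p), D.charIdeal = Ideal.span {fE} →
          D.IsTorsion ∧ SchneiderConjecture Dh ∧ Finite (AddCommGroup.primaryComponent W.sha p) ∧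
          Odd (X1.MuLambda.lam fE) ∧ 1 ≤ X1.MuLambda.lam fE ∧ X1.MuLambda.lam fE ≤ k ∧
          ∃ ℓ : ℕ, ℓ ∣ p ^ 2 ∧ (ReductionNonAnomalous W p → ℓ = 1) ∧
            (X1.MuLambda.mu fE : ℤ) + 1 + 2 * padicValNat p W.torsionOrder ≤
              (padicValNat p (Nat.card (AddCommGroup.primaryComponent W.sha p)) : ℤ) +
                (padicRegulator Dh).valuation + padicValNat p W.tamagawaProduct + padicValNat p ℓ ∧
            ((X1.MuLambda.mu fE : ℤ) + 1 + 2 * padicValNat p W.torsionOrder =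
              (padicValNat p (Nat.card (AddCommGroup.primaryComponent W.sha p)) : ℤ) +
                (padicRegulator Dh).valuation + padicValNat p W.tamagawaProduct + padicValNat p ℓ ↔
              X1.MuLambda.lam fE = 1) ∧
            (padicValNat p (Nat.card (AddCommGroup.primaryComponent W.sha p)) : ℤ) +
                (padicRegulator Dh).valuation + padicValNat p W.tamagawaProduct + padicValNat p ℓ ≤
              X1.MuLambda.mu fE + (RS 1 n₁).valuation + c + 1 + 2 * padicValNat p W.torsionOrder ∧
            ((padicValNat p (Nat.card (AddCommGroup.primaryComponent W.sha p)) : ℤ) +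
                (padicRegulator Dh).valuation + padicValNat p W.tamagawaProduct + padicValNat p ℓ =
              X1.MuLambda.mu fE + (RS 1 n₁).valuation + c + 1 + 2 * padicValNat p W.torsionOrder ↔
              X1.MuLambda.lam fE = k) ∧
            (k = 3 → X1.MuLambda.lam fE = 1 ∨ X1.MuLambda.lam fE = 3) ∧
            ∀ (m : ℕ) (v : ℤ), X1.MuLambda.mu fE ≤ m → v ≤ (padicRegulator Dh).valuation →
              (m : ℤ) + 1 + 2 * padicValNat p W.torsionOrder < v + padicValNat p W.tamagawaProduct →
              3 ≤ X1.MuLambda.lam fE ∧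
              (k = 3 → X1.MuLambda.lam fE = 3 ∧
                (padicValNat p (Nat.card (AddCommGroup.primaryComponent W.sha p)) : ℤ) +
                  (padicRegulator Dh).valuation + padicValNat p W.tamagawaProduct + padicValNat p ℓ =
                X1.MuLambda.mu fE + (RS 1 n₁).valuation + c + 1 + 2 * padicValNat p W.torsionOrder ∧
                ∃ G : IwasawaAlgebra p, D.charIdeal = Ideal.span {G} ∧
                  iwasawaToPowerSeries p G =
                    PowerSeries.C ((p : ℚ_[p]) ^ (X1.MuLambda.mu fE + c)) * B) := by
  have hp2 : p ≠ 2 := by omega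
  have hT : TameBranchRatDvdAt W p := tameBranchRatDvdAt_of_thmC hC hDel hDelM h5 hcm
  obtain ⟨B, hB, hordε, hbdB, hfk, hflt, hne, hvaleq⟩ :=
    exists_isTameBranchOf_firstTop_coeff_one_of_thm1_of_two_norm_ratTwistedSymbolSum_of_riemannSum hRS hD
      h5 hadd hGord he hf F hF w hw hã hroot hχe hu hteich hc hκ heven hord hκ' heven' hord' ht hk2 hval
      hval' hlt
  obtain ⟨hmw, -⟩ := hGZK W (by rw [hr])
  have hr1 : W.mordellWeilRank = 1 := by rw [hmw, hr]
  refine ⟨B, hB, hfk, hflt, hvaleq, Delbourgo2002.mainTheorem.exists_leadingTermClauses hDel h5 hcm hadd hGord,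
    fun Dh hBcl K γ hK hγ hcv D fE hchar ↦ ?_⟩
  haveI : Module.Finite (IwasawaAlgebra p) D.X := D.module_finite_holds hγ
  obtain ⟨hX, g, hg, k₀, hι⟩ := hT _ ã B hp2 hadd (Or.inr hGord) hK hγ hcv hf hordε hã hB D
  obtain ⟨hS, hfin, hodd, hlam1, hlamk, -, ℓ, hℓ, hna, hlow, hlowiff, hup, hupiff, hdich, hsq, hsq3⟩ :=
    sandwich_rankOne_of_iota_eq_of_firstTop h310 hp2 hr1 hBcl hK hγ hcv D hX hchar hg hι hbdB hfk hflt hne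
  rw [hvaleq] at hup hupiff hsq3
  refine ⟨hX, hS, hfin, hodd, hlam1, hlamk, ℓ, hℓ, hna, hlow, hlowiff, hup, hupiff, hdich,
    fun m v hμ hv hb ↦ ?_⟩
  haveI : Finite (AddCommGroup.primaryComponent W.sha p) := hfin
  have hSh : (0 : ℤ) ≤ padicValNat p (Nat.card (AddCommGroup.primaryComponent W.sha p)) := by
    exact_mod_cast Nat.zero_le _
  have hℓv : (0 : ℤ) ≤ padicValNat p ℓ := by exact_mod_cast Nat.zero_le _
  have hμ' : (X1.MuLambda.mu fE : ℤ) ≤ m := by exact_mod_cast hμ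
  have hstrict : (X1.MuLambda.mu fE : ℤ) + 1 + 2 * padicValNat p W.torsionOrder <
      (padicValNat p (Nat.card (AddCommGroup.primaryComponent W.sha p)) : ℤ) +
        (padicRegulator Dh).valuation + padicValNat p W.tamagawaProduct + padicValNat p ℓ := by
    linarith
  refine ⟨hsq hstrict, fun hk3 ↦ ?_⟩
  subst hk3
  obtain ⟨hlam3, heq⟩ := hsq3 rfl hstrict
  obtain ⟨-, G, hG, -, -, hιG⟩ := charIdeal_eq_span_and_iota_eq_of_squeeze_rankOne h310 hp2 hr1 hBcl hK hγ
    hcv D hX hchar hg hι hbdB hfk hflt hne hμ hv hb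
  exact ⟨hlam3, heq, G, hG, hιG⟩

end Join

end TwistPartner

end Summit.BirchSwinnertonDyer.Rank1Residual.Additive

end
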